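import Summits.CriticalPhenomena.PercolationContinuityZ3.Theorems.Transplant.SkelPhiAdvPackaging
import Summits.CriticalPhenomena.PercolationContinuityZ3.Theorems.Transplant.SkelPhiCellsConcG
import Summits.CriticalPhenomena.PercolationContinuityZ3.Theorems.Transplant.SkelTubeSub
import HarnessLib

/-!
# D″ node, (R) layer, file 2 (R-RECUT-PLAN §1 row 1; DPRIME-SCOPE p3 addenda K/M): the ROOT RESIDUE `Skelφ.RootOblS` (file 1,
# `SkelPhiAdvPackaging`; ⟹ `Skel.RootOblT` by `Skelφ.rootOblT_of_rootOblS`) of the TWO-UNIT concentric scheme of record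
# `⟨Skelφ.cellGeomSG G φ P w₀ Λ, q, δc⟩` (p2-g7's `SkelPhiCellsConcG`) at φ-LEVEL, from ONE schedule-generic WINDOW chain per direction
# `du` (p1-g9's `SkelPhiWinChainS`: planar window `Skelφ.planarWindowWin hlip w₀ Rπ` of the window graph `winGraph G w₀ Rπ`, any
# `ChainPlanar.Schedule`) with the planar facts as hypotheses — the φ-level, schedule-generic re-cut of p2-g4's `SkelConcRoot`
# (`Skel.rootOblA_concSG`, typed over `Φ : PlanarSkeletonConc G`, square cells `PCells`, straight runs `Skel.WinAdvData`)

builds on p205010 (kernel theorem, internal audit signed; external expert review pending) — nothing in this file uses p205010.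
Status sentence (coordinator 2026-08-20T04:30Z): "θ(p_c) = 0 on ℤ^d, all d ≥ 2 — kernel-verified (Lean 4/Mathlib, standard axioms); internal
adversarial audit SIGNED 2026-08-20 04:29Z; external expert review pending."
Lane `prim-bschramm-*`, seat `prim-bschramm-p2` (gen 8; (R) = p2 lineage under D″); helper file (`--supports stmt-CriticalPhenomena-4575`).

DICTIONARY (addendum K): `Φ ↦ (G, φ)`, `Φ.lip ↦ hlip` (the planar window's nesting), `Φ.step ↦ hstep` (the step device putting a window
vertex into a SPAN, and the root into its cube), cells `C : PCells ↦ P : PCells2` (two units; narrow between-box `P.BtwN`), straight run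
`(P du : Skel.WinAdvData V)` ↦ `(Sc du : ChainPlanar.Schedule, Pc du : Skelφ.WinChainData V)` read through `planarWindowWin hlip w₀ (Rπ du)`:
regions `stepD k = Win G φ w₀ (Sc.region k) Rπ`, true targets `coreT k = Win G φ w₀ (Sc.core (k+1)) Rπ`.  As in the source, the three radius
facts carry ONE UNIT OF SLACK (`Rπ + 1 ≤ rB 0 0 du`, `≤ rQ 0 (0+du)`, `≤ rM 0 (0+du)`: the regions of record are vertex spans `Skelφ.VWin`), and
the planar facts are: every region `Sc.region k ⊆ P.BtwN 0 du ∪ P.Q (0 + du)` and `Disjoint (Sc.region k) (P.Q 0)` (`k ≤ Sc.N`), the last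
core `Sc.core (Sc.N + 1) ⊆ P.M (0 + du)`.  Then the cut root world `U' := (Q_0 ∪ E_{0,du}).filter (· ∈ B_G(w₀, Rπ))` carries every region, the
root law cut to `U'` is a subbox weighting of the window graph on each region (`Skel.isSubbox_W0sub_win`), the root is off every region, and
the last core lies in `M_0(0 + du)`.  The nonemptiness of the true targets stays a hypothesis (discharged from `hstep` at the run level, file 3).
* **`Skelφ.rootOblS_concSG`** — `Skelφ.RootOblS G ⟨Skelφ.cellGeomSG G φ P w₀ Λ, q, δc⟩ Δ' δr` from `du`-indexed data `Rπ du`, `Sc du`, `Pc du`,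
  `B₀ du`, `η du`, under `hlip hstep`, `WFS2 P Λ`, `φ w₀ = 0`.
[cite: KozmaNitzan2024, §4 p. 27 (G₀), p. 28 ((32) at the root), Lemma 11 (pp. 22–23)]
-/

noncomputable section

open MeasureTheory ProbabilityTheory
open scoped ENNReal Classical

namespace Summit.CriticalPhenomena.PercolationContinuityZ3.Theorems

namespace Transplant

namespace Skelφ

open Literature.Probability.Percolation Literature.Probability.LatticeModels SimpleGraph GadgetSystem ProbeHistory HSiteScheme Contour KNCells
open KNCells.KSchA KNLevels
open Literature.Barriers.CriticalPhenomena (graphBall mem_graphBall_self)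
open BoxProdZ2 (ConcRadiiG)
open Skel (winGraph isSubbox_W0sub_win)

variable {V : Type} [DecidableEq V] {G : SimpleGraph V} [G.LocallyFinite] {φ : V → Site 2}

/-! ## §1 The root residue of the two-unit concentric scheme of record -/

/-- **THE ROOT RESIDUE OF THE TWO-UNIT CONCENTRIC SCHEME OF RECORD, φ-LEVEL** (design D″, (R), generic): `Skelφ.RootOblS` from one window chain
of a planar schedule per direction in `winGraph G w₀ Rπ` avoiding the wired root cube, three radius facts (with the step device's unit of
slack), three planar facts (narrow between-box), and — as hypotheses — the nonemptiness of the true targets, the per-step kit clauses, the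
rim excess, the first hop and the count. [cite: KozmaNitzan2024, §4 p. 28 ((32) at the root), Lemma 11 (pp. 22–23)] -/
theorem rootOblS_concSG (hlip : Lip G φ) (hstep : Steps G φ) (P : PCells2) (w₀ : V) {Λ : ConcRadiiG} (hΛ : WFS2 P Λ) (hφ : φ w₀ = 0)
    (q : unitInterval) (δc : ℝ) {Δ' : ℕ} {δr : ℕ → ℝ}
    (Rπ : MDir → ℕ) (Sc : MDir → ChainPlanar.Schedule) (Pc : MDir → WinChainData V) (B₀ : MDir → Finset V) (η : MDir → ℝ)
    -- the data of the chains
    (hPo : ∀ du, (Pc du).o = w₀)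
    (hPS : ∀ du, (Pc du).Sfin =
      ((⟨cellGeomSG G φ P w₀ Λ, q, δc⟩ : KSchA V ℕ).U0root du).filter fun y => y ∈ graphBall G w₀ (Rπ du))
    (hRl : ∀ du, (Pc du).Rlev + 1 ≤ (Sc du).R')
    (hRim : ∀ du k, (Pc du).Rim k ⊆ (planarWindowWin hlip w₀ (Rπ du)).stepD (Sc du) k) (hj : ∀ du, (Pc du).j₁ ≤ (Pc du).Rlev)
    (hTne : ∀ du, ∀ k ≤ (Sc du).N, ((planarWindowWin hlip w₀ (Rπ du)).coreT (Sc du) k).Nonempty)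
    -- three radius facts (one unit of slack: the regions of record are vertex spans)
    (hRB : ∀ du, Rπ du + 1 ≤ Λ.rB 0 0 du) (hRQ : ∀ du, Rπ du + 1 ≤ Λ.rQ 0 ((0 : Site 2) + stepVec du))
    (hRM : ∀ du, Rπ du + 1 ≤ Λ.rM 0 ((0 : Site 2) + stepVec du))
    -- three planar facts (narrow between-box)
    (hreg : ∀ du, ∀ k ≤ (Sc du).N, (Sc du).region k ⊆ P.BtwN 0 du ∪ P.Q ((0 : Site 2) + stepVec du))
    (hQ0 : ∀ du, ∀ k ≤ (Sc du).N, Disjoint ((Sc du).region k) (P.Q 0))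
    (hlast : ∀ du, (Sc du).core ((Sc du).N + 1) ⊆ P.M ((0 : Site 2) + stepVec du))
    -- the analytic inputs
    (hcount : ∀ du, 1 / (1 - (q : ℝ)) ^ (Δ' * (Pc du).N) ≤ δr (Sc du).N * ((Finset.Icc (Pc du).j₀ (Pc du).j₁).card : ℝ))
    (hkits : ∀ du, ∀ k ≤ (Sc du).N, ∀ j ∈ Finset.Icc (Pc du).j₀ (Pc du).j₁, ∃ (σ : SData V) (Sz : Finset V),
      SHyp ((Pc du).stepL (planarWindowWin hlip w₀ (Rπ du)) (Sc du) k) j σ ∧ σ.N ≤ (Pc du).N ∧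
      (1 - (q : ℝ) ^ σ.sB) ^ σ.k ≤ δr (Sc du).N ∧
      Sz ⊆ ((Pc du).stepL (planarWindowWin hlip w₀ (Rπ du)) (Sc du) k).X j ∧ Sz ⊆ (planarWindowWin hlip w₀ (Rπ du)).stepD (Sc du) k ∧
      (∀ x ∈ σ.K, ∀ e' ∈ σ.seed x, e' ∉ wireSet (↑Sz : Set V)) ∧ (∀ x ∈ σ.K, σ.face x ⊆ Sz) ∧
      (∀ x ∈ σ.K, 1 - 3 * δr (Sc du).N ≤ (prodBernoulli ((⟨cellGeomSG G φ P w₀ Λ, q, δc⟩ : KSchA V ℕ).W0sub G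
          (((⟨cellGeomSG G φ P w₀ Λ, q, δc⟩ : KSchA V ℕ).U0root du).filter fun y => y ∈ graphBall G w₀ (Rπ du)))).real
          {ω | ∃ u ∈ σ.face x,
        1 - δr (Sc du).N < (prodBernoulli (pinW ((⟨cellGeomSG G φ P w₀ Λ, q, δc⟩ : KSchA V ℕ).W0sub G
          (((⟨cellGeomSG G φ P w₀ Λ, q, δc⟩ : KSchA V ℕ).U0root du).filter fun y => y ∈ graphBall G w₀ (Rπ du)))
          (wireSet (↑Sz : Set V)) ω)).real
          (⋃ t' ∈ (Pc du).coreE (planarWindowWin hlip w₀ (Rπ du)) (Sc du) k,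
            openConnIn (↑((planarWindowWin hlip w₀ (Rπ du)).stepD (Sc du) k) : Set V) u t')}))
    (hη : ∀ du, η du ≤ δr (Sc du).N / 2)
    (hexc : ∀ du, ∀ k ≤ (Sc du).N, (prodBernoulli ((⟨cellGeomSG G φ P w₀ Λ, q, δc⟩ : KSchA V ℕ).W0sub G
        (((⟨cellGeomSG G φ P w₀ Λ, q, δc⟩ : KSchA V ℕ).U0root du).filter fun y => y ∈ graphBall G w₀ (Rπ du)))).real
        (⋃ t' ∈ (Pc du).Rim k, openConn w₀ t') ≤ η du)
    (hB₀ : ∀ du, B₀ du ⊆ ((Pc du).stepL (planarWindowWin hlip w₀ (Rπ du)) (Sc du) 0).X 0)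
    (hsrc : ∀ du, 1 - δr (Sc du).N < (prodBernoulli ((⟨cellGeomSG G φ P w₀ Λ, q, δc⟩ : KSchA V ℕ).W0sub G
        (((⟨cellGeomSG G φ P w₀ Λ, q, δc⟩ : KSchA V ℕ).U0root du).filter fun y => y ∈ graphBall G w₀ (Rπ du)))).real
        (⋃ t' ∈ B₀ du, openConn w₀ t')) :
    RootOblS G (⟨cellGeomSG G φ P w₀ Λ, q, δc⟩ : KSchA V ℕ) Δ' δr := by
  intro du
  set S := (⟨cellGeomSG G φ P w₀ Λ, q, δc⟩ : KSchA V ℕ) with hSdef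
  set U' : Finset V := (S.U0root du).filter fun y => y ∈ graphBall G w₀ (Rπ du) with hU'
  set 𝒲 : PlanarWindow (winGraph G w₀ (Rπ du)) := planarWindowWin hlip w₀ (Rπ du) with h𝒲
  have hW : ∀ Pl, 𝒲.W Pl = Win G φ w₀ Pl (Rπ du) := fun Pl => rfl
  have hw₀ : w₀ ∈ graphBall G w₀ (Rπ du) := mem_graphBall_self G w₀ _
  -- the root lies in its cube (a span: `1 ≤ rQ 0 0`, `φ w₀ = 0`, `e₀ ∈ Q_0`)
  have hrootQ : w₀ ∈ S.Γ.Q S.Γ.a₀ 0 := (sepGeomSG P w₀ hΛ hφ hstep).root_mem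
  have hrootU : w₀ ∈ U' := Finset.mem_filter.2 ⟨Finset.mem_union_left _ hrootQ, hw₀⟩
  -- every region lies in the cut root world (the step device puts a window vertex into the span)
  have hDU : ∀ k ≤ (Sc du).N, 𝒲.stepD (Sc du) k ⊆ U' := by
    intro k hk v hv
    rw [PlanarWindow.stepD, hW, mem_Win] at hv
    obtain ⟨hd, hφv⟩ := hv
    refine Finset.mem_filter.2 ⟨?_, hd⟩
    rcases Finset.mem_union.1 (hreg du k hk hφv) with h | h
    · -- the narrow between-box `BtwN_0(0, du)`
      refine Finset.mem_union_right _ (Finset.mem_union_left _ ?_)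
      change v ∈ VWin G φ w₀ (P.BtwN 0 du) (Λ.rB 0 0 du)
      exact mem_VWin_of_zdAdj hstep hd (hRB du) h (P.exists_adj_of_mem_BtwN 0 du h)
    · -- the child's cube `Q_0(0 + du)`
      refine Finset.mem_union_right _ (Finset.mem_union_right _ ?_)
      change v ∈ VWin G φ w₀ (P.Q ((0 : Site 2) + stepVec du)) (Λ.rQ 0 ((0 : Site 2) + stepVec du))
      exact mem_VWin_of_zdAdj hstep hd (hRQ du) h (P.exists_adj_of_mem_Q _ h)
  -- … and off the wired root cube (planar footprints)
  have hdis : ∀ k ≤ (Sc du).N, Disjoint (𝒲.stepD (Sc du) k) (S.Γ.Q S.Γ.a₀ 0) := by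
    intro k hk
    change Disjoint (𝒲.W ((Sc du).region k)) (VWin G φ w₀ (P.Q 0) (Λ.rQ 0 0))
    rw [hW]
    exact Finset.disjoint_left.2 fun a ha hb =>
      Finset.disjoint_left.1 (hQ0 du k hk) ((mem_Win G φ).1 ha).2 (φ_mem_of_mem_VWin hb)
  refine ⟨w₀, Rπ du, 𝒲, Sc du, Pc du, U', B₀ du, η du, hRl du, hRim du, hTne du, hPo du, Finset.filter_subset _ _, hrootU,
    ?_, ?_, ?_, ?_, ?_, hj du, hcount du, hkits du, hη du, ?_, hB₀ du, ?_, ?_⟩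
  · -- subbox in the window graph
    intro k hk
    exact isSubbox_W0sub_win G w₀ (Rπ du) (S := S) (U := S.U0root du) (hDU k hk) (hdis k hk)
  · -- finite support
    rw [hPS]; exact finSupp_W0sub
  · -- regions inside the support
    intro k hk; rw [hPS]; exact hDU k hk
  · -- the root is off every region
    intro k hk; rw [hPo]
    exact fun h' => Finset.disjoint_left.1 (hdis k hk) h' hrootQ
  · -- the root is in the support
    rw [hPo, hPS]; exact hrootU
  · -- the rim excess
    intro k hk; exact hexc du k hk
  · -- the first hop
    exact hsrc du
  · -- the last core lies in `M_0(0 + du)` (a span: step device, slack `Rπ + 1 ≤ rM`)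
    intro v hv
    rw [PlanarWindow.coreT, hW, mem_Win] at hv
    obtain ⟨hd, hφv⟩ := hv
    have h := hlast du hφv
    change v ∈ VWin G φ w₀ (P.M ((0 : Site 2) + stepVec du)) (Λ.rM 0 ((0 : Site 2) + stepVec du))
    -- (self-adjacency of the target box `cen ± 3 (r₀, r₁)`, side `6 r₀ ≥ 1`; hp-8's `PCells2.exists_adj_of_mem_M`, inlined)
    exact mem_VWin_of_zdAdj hstep hd (hRM du) h
      (PCells.exists_adj_of_mem_Icc 0 (by simp only [Pi.sub_apply, Pi.add_apply, PCells2.hw_apply]; push_cast; have := P.one_le_r 0; omega) h)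

end Skelφ

end Transplant

end Summit.CriticalPhenomena.PercolationContinuityZ3.Theorems

end
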